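import Literature.Analysis.FluidPDE.NSFourierWeights
import Mathlib.Analysis.Convolution
import Mathlib.MeasureTheory.Measure.Haar.InnerProductSpace
import Mathlib.MeasureTheory.Measure.Haar.Unique
import Mathlib.MeasureTheory.Integral.Bochner.ContinuousLinearMap
import HarnessLib

/-!
# The Fourier-side Navier–Stokes nonlinearity in weighted sup-norms

Second file of the Fourier-side construction of Leray's local regular solution
(`Literature.Fluid.local_regular_solution`, plan in `NSLocalRegular`). With the *forward* Fourier
transform as synthesis, `u(t) = 𝓕 v(t)` (`Real.fourier_eq`: `𝓕 f x = ∫ 𝐞(-⟪ξ, x⟫) f ξ dξ`), a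
space derivative `∂_h` acts on the Fourier side as the multiplier `-2πi ⟪ξ, h⟫`
(Mathlib `Real.fderiv_fourier`), products become convolutions
`𝓕 f · 𝓕 g = 𝓕 (f ⋆ g)`, `(f ⋆ g)(ξ) = ∫ f(η) g(ξ - η) dη` (Mathlib
`Real.fourier_mul_convolution_eq`), and for a divergence-free coefficient field
`v : E → ℂ^ι` (`∑ⱼ ξⱼ vⱼ(ξ) = 0`) the Leray projection of the transformed convective term
`(u·∇)u` is the bilinear expression

  `N(v, w)(ξ)_l = -2πi ∑_{j,k} m_{jkl}(ξ) (v_j ⋆ w_k)(ξ)`,  `m_{jkl}(ξ) = ξⱼ(δₖₗ − ξₖξₗ/‖ξ‖²)`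

(`lerayDerivSymbol`, file `NSFourierWeights`), while the transformed pressure is
`q(v, w)(ξ) = -∑_{j,k} (ξⱼ ξₖ/‖ξ‖²) (v_j ⋆ w_k)(ξ)` (Lemarié-Rieusset 2016, §6.1 (the symbols),
§8.5 (the weighted pseudo-measure algebra); Cannone 2004, §2.4; for Leray's theorem itself
Leray 1934, §19, Ożański–Pooley 2018, Thm. 6.22).

This file provides, for `E = EuclideanSpace ℝ ι`:

* `HasDecay K C f`: the weighted sup-norm bound `‖f ξ‖ ≤ C (1 + ‖ξ‖)^{-K}` and its algebra;
* `fconv f g = f ⋆[mul ℂ ℂ] g`, Mathlib's convolution with the multiplication pairing, with the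
  decay estimates (`HasDecay` of orders `K₀ > card ι` and `K` ⇒ order `K`, constants linear in
  the order-`K` constants), parametric continuity (dominated convergence), bilinearity and the
  conjugation symmetry `f(-ξ) = conj f(ξ)` (reality of `𝓕 f`);
* `nonlin v w` and `presSymbol v w` as above, with the bound
  `‖N(v,w)(ξ)‖ ≤ nonlinConst ι K K₀ · (A B₀ + A₀ B) · ‖ξ‖ (1+‖ξ‖)^{-K}` — the factor `‖ξ‖` is the
  one derivative the heat kernel recovers (`heatGain_le`) — continuity, bilinearity, the
  incompressibility `∑ₗ ξₗ N(v,w)(ξ)_l = 0` and the conjugation symmetry.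

## Mathlib search

`MeasureTheory.convolution` (`f ⋆[L, μ] g = fun x ↦ ∫ t, L (f t) (g (x - t)) ∂μ`),
`Integrable.integrable_convolution`, `AEStronglyMeasurable.convolution_integrand_snd`,
`continuous_of_dominated`, `integral_neg_eq_self`, `integral_conj`,
`Real.fourier_mul_convolution_eq` (used downstream). No Mathlib material on the Navier–Stokes
nonlinearity (searched `NavierStokes`, `Leray`, `Oseen`).

## References

* J. Leray, Acta Math. 63 (1934), §19. [Leray1934]
* W. S. Ożański, B. C. Pooley, in: PDE in Fluid Mechanics, LMS LN 452, CUP 2018, Thm. 6.22. [OzanskiPooley2018]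
* P. G. Lemarié-Rieusset, *The Navier–Stokes problem in the 21st century*, CRC 2016, §6.1, §8.5.
* M. Cannone, Harmonic analysis tools for solving the incompressible Navier–Stokes equations,
  Handbook of Mathematical Fluid Dynamics III (2004), §2.4.
-/

noncomputable section

open MeasureTheory Real Set Filter Topology
open scoped Convolution ComplexConjugate

namespace Literature.Analysis.FluidPDE.FourierNS

/-! ### Weighted sup-norm bounds -/

section Decay

variable {X : Type*} [NormedAddCommGroup X]
variable {F : Type*} [NormedAddCommGroup F]

/-- `HasDecay K C f`: the weighted sup-norm bound `‖f ξ‖ ≤ C (1 + ‖ξ‖)^{-K}` for all `ξ`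
(membership in the ball of radius `C` of the weighted `L^∞` / pseudo-measure space of order `K`,
Lemarié-Rieusset 2016, §8.5). [folklore] -/
def HasDecay (K : ℕ) (C : ℝ) (f : X → F) : Prop :=
  ∀ ξ, ‖f ξ‖ ≤ C * ((1 + ‖ξ‖) ^ K)⁻¹

variable {K J : ℕ} {C C' : ℝ} {f g : X → F}

/-- Unfolding `HasDecay`. [folklore] -/
theorem HasDecay.le (h : HasDecay K C f) (ξ : X) : ‖f ξ‖ ≤ C * ((1 + ‖ξ‖) ^ K)⁻¹ := h ξ

/-- The constant of a decay bound is nonnegative (test at `ξ = 0`). [folklore] -/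
theorem HasDecay.nonneg (h : HasDecay K C f) : 0 ≤ C := by
  have := h 0
  simp only [norm_zero, add_zero, one_pow, inv_one, mul_one] at this
  exact (norm_nonneg _).trans this

/-- A decaying function is bounded by its constant. [folklore] -/
theorem HasDecay.norm_le (h : HasDecay K C f) (ξ : X) : ‖f ξ‖ ≤ C :=
  (h ξ).trans (mul_le_of_le_one_right h.nonneg (inv_one_add_norm_pow_le_one ξ K))

/-- Decay bounds are monotone in the constant. [folklore] -/
theorem HasDecay.mono (h : HasDecay K C f) (hC : C ≤ C') : HasDecay K C' f := fun ξ =>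
  (h ξ).trans (mul_le_mul_of_nonneg_right hC (by positivity))

/-- Decay of order `K` implies decay of every order `J ≤ K` with the same constant. [folklore] -/
theorem HasDecay.of_le (h : HasDecay K C f) (hJ : J ≤ K) : HasDecay J C f := fun ξ =>
  (h ξ).trans (mul_le_mul_of_nonneg_left (inv_one_add_norm_pow_anti ξ hJ) h.nonneg)

/-- The zero function decays to every order with constant `0`. [folklore] -/
theorem HasDecay.zero (K : ℕ) : HasDecay K 0 (0 : X → F) := fun ξ => by simp

/-- Decay bounds add. [folklore] -/
theorem HasDecay.add (hf : HasDecay K C f) (hg : HasDecay K C' g) : HasDecay K (C + C') (f + g) :=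
  fun ξ => by
  calc ‖(f + g) ξ‖ ≤ ‖f ξ‖ + ‖g ξ‖ := norm_add_le _ _
    _ ≤ C * ((1 + ‖ξ‖) ^ K)⁻¹ + C' * ((1 + ‖ξ‖) ^ K)⁻¹ := add_le_add (hf ξ) (hg ξ)
    _ = (C + C') * ((1 + ‖ξ‖) ^ K)⁻¹ := by ring

/-- Decay bounds are invariant under negation. [folklore] -/
theorem HasDecay.neg (hf : HasDecay K C f) : HasDecay K C (-f) := fun ξ => by
  simpa using hf ξ

/-- Decay bounds subtract. [folklore] -/
theorem HasDecay.sub (hf : HasDecay K C f) (hg : HasDecay K C' g) : HasDecay K (C + C') (f - g) := by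
  simpa [sub_eq_add_neg] using hf.add hg.neg

/-- Decay of a pointwise product with a bounded scalar factor. [folklore] -/
theorem HasDecay.of_norm_le_mul {G : Type*} [NormedAddCommGroup G] {g : X → G} {M : ℝ}
    (hf : HasDecay K C f) (hM : 0 ≤ M) (hle : ∀ ξ, ‖g ξ‖ ≤ M * ‖f ξ‖) : HasDecay K (M * C) g :=
  fun ξ => (hle ξ).trans (by rw [mul_assoc]; exact mul_le_mul_of_nonneg_left (hf ξ) hM)

/-- Components of a decaying `ι → ℂ`-valued function decay with the same constant. [folklore] -/
theorem HasDecay.apply {ι : Type*} [Fintype ι] {G : ι → Type*} [∀ i, NormedAddCommGroup (G i)]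
    {v : X → ∀ i, G i} (hv : HasDecay K C v) (j : ι) : HasDecay K C (fun ξ => v ξ j) := fun ξ =>
  (norm_le_pi_norm (v ξ) j).trans (hv ξ)

/-- A decay bound for each component gives a decay bound for the `ι → G`-valued map. [folklore] -/
theorem HasDecay.of_apply {ι : Type*} [Fintype ι] {G : ι → Type*} [∀ i, NormedAddCommGroup (G i)]
    {v : X → ∀ i, G i} (hC : 0 ≤ C) (hv : ∀ j, HasDecay K C (fun ξ => v ξ j)) : HasDecay K C v :=
  fun ξ => (pi_norm_le_iff_of_nonneg (by positivity)).2 fun j => hv j ξ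

end Decay

section DecayIntegral

variable {E : Type*} [NormedAddCommGroup E] [InnerProductSpace ℝ E] [FiniteDimensional ℝ E]
  [MeasurableSpace E] [BorelSpace E]
variable {F : Type*} [NormedAddCommGroup F]
variable {K K₀ : ℕ} {C : ℝ} {f : E → F}

/-- A function with decay of order `K₀ > dim E` is integrable (given measurability). [folklore] -/
theorem HasDecay.integrable (hf : HasDecay K₀ C f) (hK₀ : Module.finrank ℝ E < K₀)
    (hfm : AEStronglyMeasurable f volume) : Integrable f :=
  Integrable.mono' ((integrable_inv_one_add_norm_pow hK₀).const_mul C) hfm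
    (Eventually.of_forall hf)

/-- Moments: if `f` decays to order `n + K₀`, `K₀ > dim E`, then `‖ξ‖^n ‖f ξ‖` is integrable
(the hypothesis of Mathlib's `Real.contDiff_fourier` / `Real.iteratedFDeriv_fourier`). [folklore] -/
theorem HasDecay.integrable_pow_mul_norm {n : ℕ} (hf : HasDecay (n + K₀) C f)
    (hK₀ : Module.finrank ℝ E < K₀) (hfm : AEStronglyMeasurable f volume) :
    Integrable (fun ξ => ‖ξ‖ ^ n * ‖f ξ‖) := by
  refine Integrable.mono' ((integrable_inv_one_add_norm_pow hK₀).const_mul C)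
    ((continuous_norm.pow n).aestronglyMeasurable.mul hfm.norm) (Eventually.of_forall fun ξ => ?_)
  rw [Real.norm_of_nonneg (by positivity)]
  have h1 : ‖ξ‖ ^ n ≤ (1 + ‖ξ‖) ^ n :=
    pow_le_pow_left₀ (norm_nonneg _) (le_add_of_nonneg_left zero_le_one) n
  have hpos : 0 < (1 + ‖ξ‖) ^ n := by positivity
  calc ‖ξ‖ ^ n * ‖f ξ‖ ≤ (1 + ‖ξ‖) ^ n * (C * ((1 + ‖ξ‖) ^ (n + K₀))⁻¹) :=
        mul_le_mul h1 (hf ξ) (norm_nonneg _) hpos.le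
    _ = C * ((1 + ‖ξ‖) ^ K₀)⁻¹ := by
        rw [pow_add, mul_inv]
        field_simp

/-- The pointwise bound `‖ξ‖^n ‖f ξ‖ ≤ C (1+‖ξ‖)^{-K}` for `f` of order `n + K`. [folklore] -/
theorem HasDecay.pow_mul_norm_le {X : Type*} [NormedAddCommGroup X] {f : X → F} {n K : ℕ}
    (hf : HasDecay (n + K) C f) (ξ : X) : ‖ξ‖ ^ n * ‖f ξ‖ ≤ C * ((1 + ‖ξ‖) ^ K)⁻¹ := by
  have h1 : ‖ξ‖ ^ n ≤ (1 + ‖ξ‖) ^ n :=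
    pow_le_pow_left₀ (norm_nonneg _) (le_add_of_nonneg_left zero_le_one) n
  have hpos : 0 < (1 + ‖ξ‖) ^ n := by positivity
  calc ‖ξ‖ ^ n * ‖f ξ‖ ≤ (1 + ‖ξ‖) ^ n * (C * ((1 + ‖ξ‖) ^ (n + K))⁻¹) :=
        mul_le_mul h1 (hf ξ) (norm_nonneg _) hpos.le
    _ = C * ((1 + ‖ξ‖) ^ K)⁻¹ := by
        rw [pow_add, mul_inv]
        field_simp

/-- Multiplication by a symbol of linear growth `‖m ξ‖ ≤ M ‖ξ‖` costs one order of decay. [folklore] -/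
theorem HasDecay.mul_linear {X : Type*} [NormedAddCommGroup X] {f : X → ℂ} {m : X → ℂ} {M : ℝ}
    {K : ℕ} (hf : HasDecay (K + 1) C f) (hM : 0 ≤ M) (hm : ∀ ξ, ‖m ξ‖ ≤ M * ‖ξ‖) :
    HasDecay K (M * C) (fun ξ => m ξ * f ξ) := fun ξ => by
  have hf' : HasDecay (1 + K) C f := by rwa [Nat.add_comm]
  rw [norm_mul]
  calc ‖m ξ‖ * ‖f ξ‖ ≤ M * ‖ξ‖ * ‖f ξ‖ := mul_le_mul_of_nonneg_right (hm ξ) (norm_nonneg _)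
    _ = M * (‖ξ‖ ^ 1 * ‖f ξ‖) := by ring
    _ ≤ M * (C * ((1 + ‖ξ‖) ^ K)⁻¹) := mul_le_mul_of_nonneg_left (hf'.pow_mul_norm_le ξ) hM
    _ = M * C * ((1 + ‖ξ‖) ^ K)⁻¹ := by ring

/-- Multiplication by a bounded symbol `‖m ξ‖ ≤ M` keeps the order of decay. [folklore] -/
theorem HasDecay.mul_bounded {X : Type*} [NormedAddCommGroup X] {f : X → ℂ} {m : X → ℂ} {M : ℝ}
    {K : ℕ} (hf : HasDecay K C f) (hM : 0 ≤ M) (hm : ∀ ξ, ‖m ξ‖ ≤ M) :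
    HasDecay K (M * C) (fun ξ => m ξ * f ξ) :=
  hf.of_norm_le_mul hM fun ξ => by
    rw [norm_mul]; exact mul_le_mul_of_nonneg_right (hm ξ) (norm_nonneg _)

end DecayIntegral

/-! ### Convolution of scalar Fourier coefficients -/

section Conv

variable {ι : Type*} [Fintype ι]

/-- The convolution `(f ⋆ g)(ξ) = ∫ f(η) g(ξ - η) dη` of two scalar functions on frequency
space, Mathlib's `f ⋆[mul ℂ ℂ] g` (so that `Real.fourier_mul_convolution_eq`,
`𝓕 (f ⋆ g) = 𝓕 f · 𝓕 g`, applies verbatim). [folklore] -/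
def fconv (f g : (EuclideanSpace ℝ ι) → ℂ) : (EuclideanSpace ℝ ι) → ℂ :=
  f ⋆[ContinuousLinearMap.mul ℂ ℂ] g

/-- Unfolding the convolution. [folklore] -/
theorem fconv_apply (f g : (EuclideanSpace ℝ ι) → ℂ) (ξ : (EuclideanSpace ℝ ι)) : fconv f g ξ = ∫ η, f η * g (ξ - η) := by
  simp [fconv, convolution_def]

/-- `fconv` is Mathlib's convolution with the multiplication pairing. [folklore] -/
theorem fconv_eq (f g : (EuclideanSpace ℝ ι) → ℂ) : fconv f g = f ⋆[ContinuousLinearMap.mul ℂ ℂ] g := rfl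

/-- `card ι = dim (EuclideanSpace ℝ ι)`, the threshold for integrability of the weights. [folklore] -/
theorem finrank_lt_of_card_lt {K₀ : ℕ} (hK₀ : Fintype.card ι < K₀) :
    Module.finrank ℝ (EuclideanSpace ℝ ι) < K₀ := by
  simpa using hK₀

variable {K K₀ : ℕ} {A₀ A B₀ B : ℝ} {f g : (EuclideanSpace ℝ ι) → ℂ}

/-- The convolution integrand is a.e.-strongly measurable. [folklore] -/
theorem aestronglyMeasurable_fconv_integrand (hfm : AEStronglyMeasurable f volume)
    (hgm : AEStronglyMeasurable g volume) (ξ : (EuclideanSpace ℝ ι)) :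
    AEStronglyMeasurable (fun η => f η * g (ξ - η)) volume :=
  hfm.convolution_integrand_snd (ContinuousLinearMap.mul ℂ ℂ) hgm ξ

/-- Components of an a.e.-strongly measurable `ι → ℂ`-valued map are a.e.-strongly
measurable. [folklore] -/
theorem aesm_apply {v : (EuclideanSpace ℝ ι) → ι → ℂ} (hv : AEStronglyMeasurable v volume) (j : ι) :
    AEStronglyMeasurable (fun η => v η j) volume :=
  (continuous_apply j).comp_aestronglyMeasurable hv

/-- **Decay of the convolution, mixed orders.** If `f`, `g` decay to the integrable order
`K₀ > card ι` (constants `A₀`, `B₀`) and to order `K` (constants `A`, `B`), then the convolution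
integrand is integrable and `‖(f ⋆ g)(ξ)‖ ≤ 2^K I_{K₀} (A B₀ + A₀ B) (1 + ‖ξ‖)^{-K}`
(`norm_integral_le_of_mixed`; Lemarié-Rieusset 2016, §8.5). [folklore] -/
theorem fconv_bound_mixed (hK₀ : Fintype.card ι < K₀) (hf₀ : HasDecay K₀ A₀ f)
    (hf : HasDecay K A f) (hg₀ : HasDecay K₀ B₀ g) (hg : HasDecay K B g)
    (hfm : AEStronglyMeasurable f volume) (hgm : AEStronglyMeasurable g volume) (ξ : (EuclideanSpace ℝ ι)) :
    Integrable (fun η => f η * g (ξ - η)) ∧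
      ‖fconv f g ξ‖ ≤ 2 ^ K * weightMass (EuclideanSpace ℝ ι) K₀ * (A * B₀ + A₀ * B) * ((1 + ‖ξ‖) ^ K)⁻¹ := by
  have h := norm_integral_le_of_mixed (E := (EuclideanSpace ℝ ι)) (F := ℂ) (finrank_lt_of_card_lt hK₀) (ξ := ξ)
    (G := fun η => f η * g (ξ - η)) hf.nonneg hg.nonneg hf₀ hf hg₀ hg
    (aestronglyMeasurable_fconv_integrand hfm hgm ξ) (fun η => (norm_mul_le _ _))
  rw [fconv_apply]
  exact h

/-- Decay of the convolution at the integrable order: `HasDecay K₀` is an algebra under `⋆`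
with constant `2^{K₀+1} I_{K₀}` (Lemarié-Rieusset 2016, §8.5). [folklore] -/
theorem hasDecay_fconv (hK₀ : Fintype.card ι < K₀) (hf : HasDecay K₀ A f) (hg : HasDecay K₀ B g)
    (hfm : AEStronglyMeasurable f volume) (hgm : AEStronglyMeasurable g volume) :
    HasDecay K₀ (2 ^ (K₀ + 1) * weightMass (EuclideanSpace ℝ ι) K₀ * (A * B)) (fconv f g) := fun ξ => by
  have h := (fconv_bound_mixed hK₀ hf hf hg hg hfm hgm ξ).2
  calc ‖fconv f g ξ‖ ≤ 2 ^ K₀ * weightMass (EuclideanSpace ℝ ι) K₀ * (A * B + A * B) * ((1 + ‖ξ‖) ^ K₀)⁻¹ := h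
    _ = 2 ^ (K₀ + 1) * weightMass (EuclideanSpace ℝ ι) K₀ * (A * B) * ((1 + ‖ξ‖) ^ K₀)⁻¹ := by rw [pow_succ]; ring

/-- Decay of the convolution to a higher order `K`, linear in the order-`K` constants. [folklore] -/
theorem hasDecay_fconv_mixed (hK₀ : Fintype.card ι < K₀) (hf₀ : HasDecay K₀ A₀ f)
    (hf : HasDecay K A f) (hg₀ : HasDecay K₀ B₀ g) (hg : HasDecay K B g)
    (hfm : AEStronglyMeasurable f volume) (hgm : AEStronglyMeasurable g volume) :
    HasDecay K (2 ^ K * weightMass (EuclideanSpace ℝ ι) K₀ * (A * B₀ + A₀ * B)) (fconv f g) := fun ξ =>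
  (fconv_bound_mixed hK₀ hf₀ hf hg₀ hg hfm hgm ξ).2

/-- The convolution of integrable functions is integrable, hence a.e.-strongly measurable
(Mathlib `Integrable.integrable_convolution`). [folklore] -/
theorem integrable_fconv (hfi : Integrable f) (hgi : Integrable g) : Integrable (fconv f g) :=
  hfi.integrable_convolution _ hgi

/-- The convolution of integrable functions is a.e.-strongly measurable. [folklore] -/
theorem aestronglyMeasurable_fconv (hfi : Integrable f) (hgi : Integrable g) :
    AEStronglyMeasurable (fconv f g) volume :=
  (integrable_fconv hfi hgi).aestronglyMeasurable

/-- Bilinearity, left: `(f₁ - f₂) ⋆ g = f₁ ⋆ g - f₂ ⋆ g` pointwise, for integrable convolution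
integrands. [folklore] -/
theorem fconv_sub_left {f₁ f₂ g : (EuclideanSpace ℝ ι) → ℂ} {ξ : (EuclideanSpace ℝ ι)} (h₁ : Integrable fun η => f₁ η * g (ξ - η))
    (h₂ : Integrable fun η => f₂ η * g (ξ - η)) :
    fconv (f₁ - f₂) g ξ = fconv f₁ g ξ - fconv f₂ g ξ := by
  simp only [fconv_apply, Pi.sub_apply, sub_mul]
  exact integral_sub h₁ h₂

/-- Bilinearity, right: `f ⋆ (g₁ - g₂) = f ⋆ g₁ - f ⋆ g₂` pointwise. [folklore] -/
theorem fconv_sub_right {f g₁ g₂ : (EuclideanSpace ℝ ι) → ℂ} {ξ : (EuclideanSpace ℝ ι)} (h₁ : Integrable fun η => f η * g₁ (ξ - η))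
    (h₂ : Integrable fun η => f η * g₂ (ξ - η)) :
    fconv f (g₁ - g₂) ξ = fconv f g₁ ξ - fconv f g₂ ξ := by
  simp only [fconv_apply, Pi.sub_apply, mul_sub]
  exact integral_sub h₁ h₂

/-- Additivity, left. [folklore] -/
theorem fconv_add_left {f₁ f₂ g : (EuclideanSpace ℝ ι) → ℂ} {ξ : (EuclideanSpace ℝ ι)} (h₁ : Integrable fun η => f₁ η * g (ξ - η))
    (h₂ : Integrable fun η => f₂ η * g (ξ - η)) :
    fconv (f₁ + f₂) g ξ = fconv f₁ g ξ + fconv f₂ g ξ := by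
  simp only [fconv_apply, Pi.add_apply, add_mul]
  exact integral_add h₁ h₂

/-- Additivity, right. [folklore] -/
theorem fconv_add_right {f g₁ g₂ : (EuclideanSpace ℝ ι) → ℂ} {ξ : (EuclideanSpace ℝ ι)} (h₁ : Integrable fun η => f η * g₁ (ξ - η))
    (h₂ : Integrable fun η => f η * g₂ (ξ - η)) :
    fconv f (g₁ + g₂) ξ = fconv f g₁ ξ + fconv f g₂ ξ := by
  simp only [fconv_apply, Pi.add_apply, mul_add]
  exact integral_add h₁ h₂

/-- Homogeneity, left. [folklore] -/
theorem fconv_smul_left (c : ℂ) (f g : (EuclideanSpace ℝ ι) → ℂ) (ξ : (EuclideanSpace ℝ ι)) :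
    fconv (c • f) g ξ = c * fconv f g ξ := by
  simp only [fconv_apply, Pi.smul_apply, smul_eq_mul, mul_assoc]
  exact integral_const_mul c _

/-- Homogeneity, right. [folklore] -/
theorem fconv_smul_right (c : ℂ) (f g : (EuclideanSpace ℝ ι) → ℂ) (ξ : (EuclideanSpace ℝ ι)) :
    fconv f (c • g) ξ = c * fconv f g ξ := by
  simp only [fconv_apply, Pi.smul_apply, smul_eq_mul]
  rw [← integral_const_mul]
  congr 1 with η; ring

/-- **Conjugation symmetry.** If `f(-ξ) = conj f(ξ)` and `g(-ξ) = conj g(ξ)` (the Fourier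
coefficients of real fields) then `(f ⋆ g)(-ξ) = conj (f ⋆ g)(ξ)` (substitute `η ↦ -η`,
`integral_neg_eq_self`, `integral_conj`). [folklore] -/
theorem fconv_conj_symm (hf : ∀ ξ, f (-ξ) = conj (f ξ)) (hg : ∀ ξ, g (-ξ) = conj (g ξ)) (ξ : (EuclideanSpace ℝ ι)) :
    fconv f g (-ξ) = conj (fconv f g ξ) := by
  rw [fconv_apply, fconv_apply, ← integral_conj,
    ← integral_neg_eq_self (fun η => f η * g (-ξ - η)) volume]
  congr 1 with η
  rw [map_mul, ← hf, ← hg]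
  congr 2
  abel

/-- **Parametric continuity of the convolution** (dominated convergence). Let `X` be a first
countable topological space of parameters, `f g : X → (EuclideanSpace ℝ ι) → ℂ` with measurable slices, uniform
decay of the integrable order `K₀ > card ι`, `x ↦ f x η` continuous for every `η` and
`x ↦ g x (ζ x - η)` continuous for every `η` (`ζ : X → (EuclideanSpace ℝ ι)` the frequency at which the convolution
is evaluated). Then `x ↦ (f x ⋆ g x)(ζ x)` is continuous. Used with `X = ℝ × (EuclideanSpace ℝ ι)` (joint
continuity in time and frequency) and `X = ℝ` (continuity in time at a fixed frequency). [folklore] -/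
theorem continuous_fconv_param {X : Type*} [TopologicalSpace X] [FirstCountableTopology X]
    (hK₀ : Fintype.card ι < K₀) {F G : X → (EuclideanSpace ℝ ι) → ℂ} {ζ : X → (EuclideanSpace ℝ ι)}
    (hFm : ∀ x, AEStronglyMeasurable (F x) volume) (hGm : ∀ x, AEStronglyMeasurable (G x) volume)
    (hF : ∀ x, HasDecay K₀ A (F x)) (hG : ∀ x, HasDecay K₀ B (G x))
    (hFc : ∀ η, Continuous fun x => F x η) (hGc : ∀ η, Continuous fun x => G x (ζ x - η)) :
    Continuous fun x => fconv (F x) (G x) (ζ x) := by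
  simp_rw [fconv_apply]
  refine continuous_of_dominated (bound := fun η => A * B * ((1 + ‖η‖) ^ K₀)⁻¹)
    (fun x => aestronglyMeasurable_fconv_integrand (hFm x) (hGm x) (ζ x))
    (fun x => Eventually.of_forall fun η => ?_)
    ((integrable_inv_one_add_norm_pow (finrank_lt_of_card_lt hK₀)).const_mul (A * B))
    (Eventually.of_forall fun η => (hFc η).mul (hGc η))
  rw [norm_mul]
  have hB : 0 ≤ B := (hG x).nonneg
  calc ‖F x η‖ * ‖G x (ζ x - η)‖ ≤ A * ((1 + ‖η‖) ^ K₀)⁻¹ * B :=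
        mul_le_mul (hF x η) ((hG x).norm_le _) (norm_nonneg _)
          (le_trans (norm_nonneg _) (hF x η))
    _ = A * B * ((1 + ‖η‖) ^ K₀)⁻¹ := by ring

end Conv

/-! ### The projected nonlinearity and the pressure symbol -/

section Nonlin

variable {ι : Type*} [Fintype ι] [DecidableEq ι]

/-- The Leray-projected Fourier-side convective term
`N(v, w)(ξ)_l = -2πi ∑_{j,k} m_{jkl}(ξ) (v_j ⋆ w_k)(ξ)`, the Fourier multiplier form of
`ℙ[(u·∇)ũ]` for `u = 𝓕 v` divergence free and `ũ = 𝓕 w` (Lemarié-Rieusset 2016, §6.1;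
Cannone 2004, §2.4). Bilinear in `(v, w)`; the solution is the fixed point of the Duhamel map
built from `N(v, v)`. [folklore] -/
def nonlin (v w : (EuclideanSpace ℝ ι) → ι → ℂ) (ξ : (EuclideanSpace ℝ ι)) : ι → ℂ := fun l =>
  -(2 * π * Complex.I) * ∑ j, ∑ k, (lerayDerivSymbol j k l ξ : ℂ) * fconv (v · j) (w · k) ξ

/-- The Fourier-side pressure `q(v, w)(ξ) = -∑_{j,k} (ξⱼ ξₖ / ‖ξ‖²) (v_j ⋆ w_k)(ξ)`, i.e.
`p = -∑ RⱼRₖ(uⱼ ũₖ)` up to the sign conventions of `𝓕` (Lemarié-Rieusset 2016, §6.1). The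
symbol `ξⱼξₖ/‖ξ‖²` is bounded by `1` but discontinuous at `ξ = 0` (value `0` there). [folklore] -/
def presSymbol (v w : (EuclideanSpace ℝ ι) → ι → ℂ) (ξ : (EuclideanSpace ℝ ι)) : ℂ :=
  -∑ j, ∑ k, ((ξ j * ξ k / ‖ξ‖ ^ 2 : ℝ) : ℂ) * fconv (v · j) (w · k) ξ

/-- Unfolding a component of `nonlin`. [folklore] -/
theorem nonlin_apply (v w : (EuclideanSpace ℝ ι) → ι → ℂ) (ξ : (EuclideanSpace ℝ ι)) (l : ι) :
    nonlin v w ξ l =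
      -(2 * π * Complex.I) * ∑ j, ∑ k, (lerayDerivSymbol j k l ξ : ℂ) * fconv (v · j) (w · k) ξ :=
  rfl

omit [DecidableEq ι] in
/-- The constant `C(ι, K, K₀) = 4π (card ι)² 2^K I_{K₀}` of the nonlinear estimate. [folklore] -/
def nonlinConst (ι : Type*) [Fintype ι] (K K₀ : ℕ) : ℝ :=
  4 * π * (Fintype.card ι : ℝ) ^ 2 * 2 ^ K * weightMass (EuclideanSpace ℝ ι) K₀

omit [DecidableEq ι] in
/-- `0 ≤ C(ι, K, K₀)`. [folklore] -/
theorem nonlinConst_nonneg (K K₀ : ℕ) : 0 ≤ nonlinConst ι K K₀ := by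
  unfold nonlinConst
  have := weightMass_nonneg (E := (EuclideanSpace ℝ ι)) K₀
  positivity

variable {K K₀ : ℕ} {A₀ A B₀ B : ℝ} {v w : (EuclideanSpace ℝ ι) → ι → ℂ}

omit [DecidableEq ι] in
/-- `‖∑ j, ∑ k, a j k‖ ≤ (card ι)² M` when every term is bounded by `M`. [folklore] -/
theorem norm_sum_sum_le {a : ι → ι → ℂ} {M : ℝ} (h : ∀ j k, ‖a j k‖ ≤ M) :
    ‖∑ j, ∑ k, a j k‖ ≤ (Fintype.card ι : ℝ) ^ 2 * M := by
  calc ‖∑ j, ∑ k, a j k‖ ≤ ∑ j, ‖∑ k, a j k‖ := norm_sum_le _ _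
    _ ≤ ∑ j, ∑ k, ‖a j k‖ := Finset.sum_le_sum fun j _ => norm_sum_le _ _
    _ ≤ ∑ _j : ι, ∑ _k : ι, M := Finset.sum_le_sum fun j _ => Finset.sum_le_sum fun k _ => h j k
    _ = (Fintype.card ι : ℝ) ^ 2 * M := by simp [Finset.sum_const, Finset.card_univ]; ring

/-- **The nonlinear estimate, mixed orders.** For `v`, `w` with decay of the integrable order
`K₀ > card ι` (constants `A₀`, `B₀`) and of order `K` (constants `A`, `B`), measurable,
`‖N(v, w)(ξ)‖ ≤ C(ι, K, K₀) (A B₀ + A₀ B) ‖ξ‖ (1 + ‖ξ‖)^{-K}` (symbol bound `2‖ξ‖` times the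
convolution estimate; Lemarié-Rieusset 2016, §8.5). [folklore] -/
theorem norm_nonlin_le_mixed (hK₀ : Fintype.card ι < K₀) (hv₀ : HasDecay K₀ A₀ v)
    (hv : HasDecay K A v) (hw₀ : HasDecay K₀ B₀ w) (hw : HasDecay K B w)
    (hvm : AEStronglyMeasurable v volume) (hwm : AEStronglyMeasurable w volume) (ξ : (EuclideanSpace ℝ ι)) :
    ‖nonlin v w ξ‖ ≤ nonlinConst ι K K₀ * (A * B₀ + A₀ * B) * ‖ξ‖ * ((1 + ‖ξ‖) ^ K)⁻¹ := by
  have hA : 0 ≤ A := hv.nonneg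
  have hB : 0 ≤ B := hw.nonneg
  have hA₀ : 0 ≤ A₀ := hv₀.nonneg
  have hB₀ : 0 ≤ B₀ := hw₀.nonneg
  have hI := weightMass_nonneg (E := (EuclideanSpace ℝ ι)) K₀
  have hC0 := nonlinConst_nonneg (ι := ι) K K₀
  set X := 2 ^ K * weightMass (EuclideanSpace ℝ ι) K₀ * (A * B₀ + A₀ * B) * ((1 + ‖ξ‖) ^ K)⁻¹ with hX
  have hX0 : 0 ≤ X := by positivity
  have hconv : ∀ j k, ‖fconv (v · j) (w · k) ξ‖ ≤ X := fun j k =>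
    (fconv_bound_mixed hK₀ (hv₀.apply j) (hv.apply j) (hw₀.apply k) (hw.apply k)
      (aesm_apply hvm j)
      (aesm_apply hwm k) ξ).2
  have hterm : ∀ j k l, ‖(lerayDerivSymbol j k l ξ : ℂ) * fconv (v · j) (w · k) ξ‖ ≤
      2 * ‖ξ‖ * X := fun j k l => by
    rw [norm_mul]
    exact mul_le_mul (norm_ofReal_lerayDerivSymbol_le j k l ξ) (hconv j k) (norm_nonneg _)
      (by positivity)
  refine (pi_norm_le_iff_of_nonneg (by positivity)).2 fun l => ?_
  rw [nonlin_apply, norm_mul]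
  have h2π : ‖-(2 * (π : ℂ) * Complex.I)‖ = 2 * π := by
    simp [Complex.norm_real, Real.norm_eq_abs, abs_of_pos Real.pi_pos]
  rw [h2π]
  calc 2 * π * ‖∑ j, ∑ k, (lerayDerivSymbol j k l ξ : ℂ) * fconv (v · j) (w · k) ξ‖
      ≤ 2 * π * ((Fintype.card ι : ℝ) ^ 2 * (2 * ‖ξ‖ * X)) :=
        mul_le_mul_of_nonneg_left (norm_sum_sum_le fun j k => hterm j k l) (by positivity)
    _ = nonlinConst ι K K₀ * (A * B₀ + A₀ * B) * ‖ξ‖ * ((1 + ‖ξ‖) ^ K)⁻¹ := by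
        simp only [hX, nonlinConst]; ring

/-- The nonlinear estimate at the integrable order:
`‖N(v, w)(ξ)‖ ≤ 2 C(ι, K₀, K₀) A B ‖ξ‖ (1 + ‖ξ‖)^{-K₀}`. [folklore] -/
theorem norm_nonlin_le (hK₀ : Fintype.card ι < K₀) (hv : HasDecay K₀ A v) (hw : HasDecay K₀ B w)
    (hvm : AEStronglyMeasurable v volume) (hwm : AEStronglyMeasurable w volume) (ξ : (EuclideanSpace ℝ ι)) :
    ‖nonlin v w ξ‖ ≤ nonlinConst ι K₀ K₀ * (2 * (A * B)) * ‖ξ‖ * ((1 + ‖ξ‖) ^ K₀)⁻¹ := by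
  have h := norm_nonlin_le_mixed hK₀ hv hv hw hw hvm hwm ξ
  calc ‖nonlin v w ξ‖ ≤ nonlinConst ι K₀ K₀ * (A * B + A * B) * ‖ξ‖ * ((1 + ‖ξ‖) ^ K₀)⁻¹ := h
    _ = nonlinConst ι K₀ K₀ * (2 * (A * B)) * ‖ξ‖ * ((1 + ‖ξ‖) ^ K₀)⁻¹ := by ring

/-- The nonlinearity loses the factor `‖ξ‖ ≤ 1 + ‖ξ‖`: as a decay bound of order `K - 1`… stated
for order `K` from inputs of order `K + 1`:
`HasDecay K (C(ι,K+1,K₀)(A B₀ + A₀ B)) (N(v,w))`. [folklore] -/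
theorem hasDecay_nonlin (hK₀ : Fintype.card ι < K₀) (hv₀ : HasDecay K₀ A₀ v)
    (hv : HasDecay (K + 1) A v) (hw₀ : HasDecay K₀ B₀ w) (hw : HasDecay (K + 1) B w)
    (hvm : AEStronglyMeasurable v volume) (hwm : AEStronglyMeasurable w volume) :
    HasDecay K (nonlinConst ι (K + 1) K₀ * (A * B₀ + A₀ * B)) (nonlin v w) := fun ξ => by
  have h := norm_nonlin_le_mixed hK₀ hv₀ hv hw₀ hw hvm hwm ξ
  have hC : 0 ≤ nonlinConst ι (K + 1) K₀ * (A * B₀ + A₀ * B) := by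
    have := nonlinConst_nonneg (ι := ι) (K + 1) K₀
    have := hv.nonneg; have := hw.nonneg; have := hv₀.nonneg; have := hw₀.nonneg
    positivity
  calc ‖nonlin v w ξ‖ ≤ nonlinConst ι (K + 1) K₀ * (A * B₀ + A₀ * B) * ‖ξ‖ *
        ((1 + ‖ξ‖) ^ (K + 1))⁻¹ := h
    _ = nonlinConst ι (K + 1) K₀ * (A * B₀ + A₀ * B) * (‖ξ‖ * ((1 + ‖ξ‖) ^ (K + 1))⁻¹) := by
        ring
    _ ≤ nonlinConst ι (K + 1) K₀ * (A * B₀ + A₀ * B) * ((1 + ‖ξ‖) ^ K)⁻¹ := by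
        apply mul_le_mul_of_nonneg_left _ hC
        have hpos : 0 < 1 + ‖ξ‖ := by positivity
        rw [pow_succ, mul_inv, ← mul_assoc, mul_comm ‖ξ‖, mul_assoc]
        apply mul_le_of_le_one_right (by positivity)
        rw [mul_inv_le_iff₀ hpos, one_mul]
        linarith [norm_nonneg ξ]

/-- **Incompressibility of the projected term**: `∑ₗ ξₗ N(v, w)(ξ)_l = 0` for all `v`, `w`, `ξ`
(`sum_mul_lerayDerivSymbol`). Hence every Duhamel iterate built from `N` is divergence free on
the Fourier side. [folklore] -/
theorem sum_mul_nonlin (v w : (EuclideanSpace ℝ ι) → ι → ℂ) (ξ : (EuclideanSpace ℝ ι)) : ∑ l, (ξ l : ℂ) * nonlin v w ξ l = 0 := by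
  simp only [nonlin_apply, Finset.mul_sum, ← mul_assoc]
  rw [Finset.sum_comm]
  refine Finset.sum_eq_zero fun j _ => ?_
  rw [Finset.sum_comm]
  refine Finset.sum_eq_zero fun k _ => ?_
  have h := sum_mul_lerayDerivSymbol j k ξ
  have h' : ∑ l, (ξ l : ℂ) * (lerayDerivSymbol j k l ξ : ℂ) = 0 := by
    rw [← Complex.ofReal_zero, ← h, Complex.ofReal_sum]
    simp [Complex.ofReal_mul]
  calc ∑ l, (ξ l : ℂ) * -(2 * π * Complex.I) * (lerayDerivSymbol j k l ξ : ℂ) *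
        fconv (v · j) (w · k) ξ
      = (-(2 * π * Complex.I) * fconv (v · j) (w · k) ξ) *
          ∑ l, (ξ l : ℂ) * (lerayDerivSymbol j k l ξ : ℂ) := by
        rw [Finset.mul_sum]; congr 1 with l; ring
    _ = 0 := by rw [h', mul_zero]

/-- The nonlinearity vanishes at the zero frequency (`m_{jkl}(0) = 0`). [folklore] -/
@[simp]
theorem nonlin_zero_freq (v w : (EuclideanSpace ℝ ι) → ι → ℂ) : nonlin v w 0 = 0 := by
  ext l
  simp [nonlin_apply]

/-- **Conjugation symmetry of the nonlinearity**: if `v(-ξ) = conj v(ξ)` and `w(-ξ) = conj w(ξ)`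
componentwise then `N(v, w)(-ξ) = conj N(v, w)(ξ)` (the symbol is real and odd, `conj(-2πi) =
2πi`). [folklore] -/
theorem nonlin_conj_symm (hv : ∀ ξ j, v (-ξ) j = conj (v ξ j)) (hw : ∀ ξ j, w (-ξ) j = conj (w ξ j))
    (ξ : (EuclideanSpace ℝ ι)) (l : ι) : nonlin v w (-ξ) l = conj (nonlin v w ξ l) := by
  simp only [nonlin_apply, map_mul, map_neg, map_sum, Complex.conj_ofReal, lerayDerivSymbol_neg,
    Complex.ofReal_neg]
  have hc : ∀ j k, fconv (v · j) (w · k) (-ξ) = conj (fconv (v · j) (w · k) ξ) := fun j k =>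
    fconv_conj_symm (fun η => hv η j) (fun η => hw η k) ξ
  simp only [hc, map_ofNat, Complex.conj_I]
  simp only [neg_mul, Finset.sum_neg_distrib, mul_neg, neg_neg]

/-- Bilinearity of `N` in the first slot (pointwise, for coefficient fields with integrable
decay). [folklore] -/
theorem nonlin_sub_left {v₁ v₂ w : (EuclideanSpace ℝ ι) → ι → ℂ} (hK₀ : Fintype.card ι < K₀) {A₁ A₂ B : ℝ}
    (h₁ : HasDecay K₀ A₁ v₁) (h₂ : HasDecay K₀ A₂ v₂) (hw : HasDecay K₀ B w)
    (h₁m : AEStronglyMeasurable v₁ volume) (h₂m : AEStronglyMeasurable v₂ volume)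
    (hwm : AEStronglyMeasurable w volume) (ξ : (EuclideanSpace ℝ ι)) :
    nonlin (v₁ - v₂) w ξ = nonlin v₁ w ξ - nonlin v₂ w ξ := by
  ext l
  simp only [nonlin_apply, Pi.sub_apply]
  have hint : ∀ (u : (EuclideanSpace ℝ ι) → ι → ℂ) {Au : ℝ}, HasDecay K₀ Au u → AEStronglyMeasurable u volume →
      ∀ j k, Integrable fun η => u η j * w (ξ - η) k := fun u Au hu hum j k =>
    (fconv_bound_mixed hK₀ (hu.apply j) (hu.apply j) (hw.apply k) (hw.apply k)
      (aesm_apply hum j)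
      (aesm_apply hwm k) ξ).1
  have hsub : ∀ j k, fconv (fun η => v₁ η j - v₂ η j) (w · k) ξ =
      fconv (v₁ · j) (w · k) ξ - fconv (v₂ · j) (w · k) ξ := fun j k =>
    fconv_sub_left (f₁ := (v₁ · j)) (f₂ := (v₂ · j)) (hint v₁ h₁ h₁m j k) (hint v₂ h₂ h₂m j k)
  simp only [hsub, mul_sub, Finset.sum_sub_distrib]

/-- Bilinearity of `N` in the second slot. [folklore] -/
theorem nonlin_sub_right {v w₁ w₂ : (EuclideanSpace ℝ ι) → ι → ℂ} (hK₀ : Fintype.card ι < K₀) {A B₁ B₂ : ℝ}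
    (hv : HasDecay K₀ A v) (h₁ : HasDecay K₀ B₁ w₁) (h₂ : HasDecay K₀ B₂ w₂)
    (hvm : AEStronglyMeasurable v volume) (h₁m : AEStronglyMeasurable w₁ volume)
    (h₂m : AEStronglyMeasurable w₂ volume) (ξ : (EuclideanSpace ℝ ι)) :
    nonlin v (w₁ - w₂) ξ = nonlin v w₁ ξ - nonlin v w₂ ξ := by
  ext l
  simp only [nonlin_apply, Pi.sub_apply]
  have hint : ∀ (u : (EuclideanSpace ℝ ι) → ι → ℂ) {Bu : ℝ}, HasDecay K₀ Bu u → AEStronglyMeasurable u volume →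
      ∀ j k, Integrable fun η => v η j * u (ξ - η) k := fun u Bu hu hum j k =>
    (fconv_bound_mixed hK₀ (hv.apply j) (hv.apply j) (hu.apply k) (hu.apply k)
      (aesm_apply hvm j)
      (aesm_apply hum k) ξ).1
  have hsub : ∀ j k, fconv (v · j) (fun η => w₁ η k - w₂ η k) ξ =
      fconv (v · j) (w₁ · k) ξ - fconv (v · j) (w₂ · k) ξ := fun j k =>
    fconv_sub_right (g₁ := (w₁ · k)) (g₂ := (w₂ · k)) (hint w₁ h₁ h₁m j k) (hint w₂ h₂ h₂m j k)
  simp only [hsub, mul_sub, Finset.sum_sub_distrib]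

/-- `N(v,v) - N(w,w) = N(v - w, v) + N(w, v - w)`. [folklore] -/
theorem nonlin_self_sub_self {v w : (EuclideanSpace ℝ ι) → ι → ℂ} (hK₀ : Fintype.card ι < K₀) {A B : ℝ}
    (hv : HasDecay K₀ A v) (hw : HasDecay K₀ B w)
    (hvm : AEStronglyMeasurable v volume) (hwm : AEStronglyMeasurable w volume) (ξ : (EuclideanSpace ℝ ι)) :
    nonlin v v ξ - nonlin w w ξ = nonlin (v - w) v ξ + nonlin w (v - w) ξ := by
  rw [nonlin_sub_left hK₀ hv hw hv hvm hwm hvm, nonlin_sub_right hK₀ hw hv hw hwm hvm hwm]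
  abel

/-- **Parametric continuity of the nonlinearity.** For parameter-dependent coefficient fields
`V W : X → (EuclideanSpace ℝ ι) → ℂ^ι` with measurable slices, uniform decay of the integrable order, `x ↦ V x η`
continuous and `x ↦ W x (ζ x - η)` continuous for every `η`, and `ζ` continuous, the map
`x ↦ N(V x, W x)(ζ x)` is continuous. [folklore] -/
theorem continuous_nonlin_param {X : Type*} [TopologicalSpace X] [FirstCountableTopology X]
    (hK₀ : Fintype.card ι < K₀) {V W : X → (EuclideanSpace ℝ ι) → ι → ℂ} {ζ : X → (EuclideanSpace ℝ ι)} {A B : ℝ}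
    (hVm : ∀ x, AEStronglyMeasurable (V x) volume) (hWm : ∀ x, AEStronglyMeasurable (W x) volume)
    (hV : ∀ x, HasDecay K₀ A (V x)) (hW : ∀ x, HasDecay K₀ B (W x))
    (hVc : ∀ η, Continuous fun x => V x η) (hWc : ∀ η, Continuous fun x => W x (ζ x - η))
    (hζ : Continuous ζ) :
    Continuous fun x => nonlin (V x) (W x) (ζ x) := by
  apply continuous_pi fun l => ?_
  simp only [nonlin_apply]
  refine continuous_const.mul (continuous_finsetSum _ fun j _ => continuous_finsetSum _
    fun k _ => ?_)
  refine (Complex.continuous_ofReal.comp ((continuous_lerayDerivSymbol j k l).comp hζ)).mul ?_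
  exact continuous_fconv_param hK₀ (F := fun x η => V x η j) (G := fun x η => W x η k)
    (fun x => aesm_apply (hVm x) j) (fun x => aesm_apply (hWm x) k)
    (fun x => (hV x).apply j) (fun x => (hW x).apply k)
    (fun η => (continuous_apply j).comp (hVc η)) (fun η => (continuous_apply k).comp (hWc η))

omit [DecidableEq ι] in
/-- The pressure symbol is bounded by the same convolution estimate (the multiplier
`ξⱼξₖ/‖ξ‖²` has modulus `≤ 1`): `‖q(v,w)(ξ)‖ ≤ (card ι)² 2^K I_{K₀} (A B₀ + A₀ B)(1+‖ξ‖)^{-K}`. [folklore] -/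
theorem norm_presSymbol_le_mixed (hK₀ : Fintype.card ι < K₀) (hv₀ : HasDecay K₀ A₀ v)
    (hv : HasDecay K A v) (hw₀ : HasDecay K₀ B₀ w) (hw : HasDecay K B w)
    (hvm : AEStronglyMeasurable v volume) (hwm : AEStronglyMeasurable w volume) (ξ : (EuclideanSpace ℝ ι)) :
    ‖presSymbol v w ξ‖ ≤ (Fintype.card ι : ℝ) ^ 2 *
      (2 ^ K * weightMass (EuclideanSpace ℝ ι) K₀ * (A * B₀ + A₀ * B) * ((1 + ‖ξ‖) ^ K)⁻¹) := by
  rw [presSymbol, norm_neg]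
  refine norm_sum_sum_le fun j k => ?_
  rw [norm_mul]
  have h1 : ‖((ξ j * ξ k / ‖ξ‖ ^ 2 : ℝ) : ℂ)‖ ≤ 1 := by
    rw [Complex.norm_real, Real.norm_eq_abs]; exact abs_mul_div_norm_sq_le_one j k ξ
  have h2 := (fconv_bound_mixed hK₀ (hv₀.apply j) (hv.apply j) (hw₀.apply k) (hw.apply k)
      (aesm_apply hvm j)
      (aesm_apply hwm k) ξ).2
  calc ‖((ξ j * ξ k / ‖ξ‖ ^ 2 : ℝ) : ℂ)‖ * ‖fconv (v · j) (w · k) ξ‖ ≤ 1 * ‖fconv (v · j) (w · k) ξ‖ :=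
        mul_le_mul_of_nonneg_right h1 (norm_nonneg _)
    _ ≤ _ := by rw [one_mul]; exact h2

end Nonlin

end Literature.Analysis.FluidPDE.FourierNS

end
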